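/-
Copyright (c) 2026 the pub-hodgecm-mathlib formalisation cell (harness21).  Prover seat hodgecm-mathlib-A-p03 (g24); LEAD F0P3a-plan (g9) WORD T8-41 «(F4)–(F8) PEN 1»,
architect A-p06 (g26) MAP v3 §2 (F5), 2026-09-01.
-/
import Literature.NumberTheory.Rogawski1990.UnitOrbitalIntegralInertPiecewise
import Literature.NumberTheory.Rogawski1990.UnitFundamentalLemmaInertFlickerAlgebra
import HarnessLib

/-!
# Flicker's unit orbital integrals at an inert place — THE SUMMATION IDENTITY «Cor. 9 + Prop. 10 ⇒ Prop. 11» (`θ̄ = 1`), kernel-checked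

Topic `NumberTheory/Rogawski1990` (road «D-N7-inert», MAP v3 (F5), LAYER A of the census `CENSUS-F4-F8-FlickerCongruenceVolumes.A-p03g24.md`); namespace
`Literature.NumberTheory.Rogawski1990.Flicker1998`.  THEOREMS ONLY (no `def`, no instance, no notation, no named fact, no `sorry`); kernel lane.

THE MATHEMATICS [Flicker1998UnitaryFL, Cor. 9 p. 85, Prop. 10 p. 85, Prop. 11 pp. 87–89].  For the torus of parity `θ̄ = 1` Flicker's Cor. 9 writes the unit orbital
integral as `Φ(t_θ) = Σ_{j odd} [R_E^× : R_E(j)^×] · Σ_{m ≥ 0} I(j,m)` with `I(j,m)` the normalised volumes of Prop. 10 (★ `iTen`, a function of `ν = N − j`, `N₊`, `m`),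
and pp. 87–89 sum the resulting geometric series to the closed form of Prop. 11 (★ `phiOne`).  This file proves that summation AS AN IDENTITY OF RATIONAL FUNCTIONS, for
ALL `q > 1`, `N`, `N₊`: **`sumThetaOne q N N₊ = phiOne q N₊ N`** (★ `sumThetaOne` = Cor. 9's double sum over the printed table ★ `iTen`).  [In Flicker's situation
`N₊ = N₁ (= N₂)` when `N > N₁` and `N₊ ≥ N` when `N ≤ N₁`, and `phiOne q N₁ N` does not see `N₁` in the latter range, so this is exactly «Prop. 10 ⇒ Prop. 11»; the
identity happens to hold with no constraint at all.]  Method (not Flicker's page-long bookkeeping): the inner sum has the closed form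
`S(ν) = 1 + (1 − q⁻²) Σ_{1 ≤ m ≤ K} q^{4m} + δ(ν = N₊)(1 + q⁻¹) Σ_{[ν∕2] < m ≤ ν} q^{ν+2m}`, `K = min([ν∕2],[N₊∕2])` (`innerSumTen_eq`); re-indexing Cor. 9's sum
by `ν = N − j` gives the RECURRENCE `Φ(N+2) = q² Φ(N) + (1+q⁻¹) q · S(N+1)` (`sumThetaOne_add_two`), and the printed closed form satisfies the same recurrence
(`phiOne_add_two`, four position cases `N+2 ≤ N₊ ∕ N+1 = N₊ ∕ N = N₊ ∕ N₊ < N` × parities, each a `field_simp; ring` identity) with the same initial values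
`Φ(0) = 0`, `Φ(1) = q + 1` — whence the theorem by two-step induction (`sumThetaOne_eq_phiOne`).  The VOLUME content of Prop. 10 (that `iTen` IS the volume) is
LAYER B and is not asserted here.  Numerically pre-certified: `F0/P3a/A-p03/g24/flicker_tables.A-p03g24.py` (07557992).
HONEST LABEL: HC_CM is proved only modulo the printed citations until rung 0 closes; this file is arithmetic.

## References
* [Flicker1998UnitaryFL] Y. Z. Flicker, *Elementary proof of the fundamental lemma for a unitary group*, Canad. J. Math. 50 (1998), 74–98: Cor. 9 p. 85, Prop. 10 p. 85,
  Prop. 11 pp. 87–89.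
* [Rogawski1990] J. D. Rogawski, *Automorphic Representations of Unitary Groups in Three Variables* (1990), §4.9 Prop. 4.9.1 (b) p. 55.
-/

set_option autoImplicit false

namespace Literature.NumberTheory.Rogawski1990.Flicker1998

open Finset

variable {q : ℕ}

/-! ## §1 Geometric sums -/

/-- `q > 1 ⇒ q^c − 1 ≠ 0` (`c ≥ 1`) in `ℚ`. [cite: Flicker1998UnitaryFL, Prop. 11 p. 88] -/
theorem cast_pow_sub_one_ne_zero (hq : 1 < q) {c : ℕ} (hc : 0 < c) : (q : ℚ) ^ c - 1 ≠ 0 := by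
  have h1 : (1 : ℚ) < q := by exact_mod_cast hq
  have : (1 : ℚ) < (q : ℚ) ^ c := one_lt_pow₀ h1 hc.ne'
  linarith

/-- **Finite geometric sum** `Σ_{a ≤ m < b} q^{cm} = (q^{cb} − q^{ca})∕(q^c − 1)`. [cite: Flicker1998UnitaryFL, Prop. 11 p. 88] -/
theorem sum_Ico_pow_mul (hq : 1 < q) {c : ℕ} (hc : 0 < c) {a b : ℕ} (hab : a ≤ b) :
    ∑ m ∈ Ico a b, (q : ℚ) ^ (c * m) = ((q : ℚ) ^ (c * b) - (q : ℚ) ^ (c * a)) / ((q : ℚ) ^ c - 1) := by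
  have hne := cast_pow_sub_one_ne_zero hq hc
  induction b, hab using Nat.le_induction with
  | base => simp
  | succ b hab ih =>
    rw [Finset.sum_Ico_succ_top hab, ih]
    rw [div_add' _ _ _ hne, div_left_inj' hne]
    ring

/-- `Σ_{1 ≤ m ≤ K} q^{4m} = (q^{4(K+1)} − q^4)∕(q⁴ − 1)`. [cite: Flicker1998UnitaryFL, Prop. 11 p. 88] -/
theorem sum_Ico_one_pow_four (hq : 1 < q) (K : ℕ) :
    ∑ m ∈ Ico 1 (K + 1), (q : ℚ) ^ (4 * m) = ((q : ℚ) ^ (4 * (K + 1)) - (q : ℚ) ^ 4) / ((q : ℚ) ^ 4 - 1) := by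
  rw [sum_Ico_pow_mul hq (by norm_num : 0 < 4) (by omega : 1 ≤ K + 1), mul_one]

/-- `Σ_{a ≤ m < b} q^{ν+2m} = q^ν (q^{2b} − q^{2a})∕(q² − 1)`. [cite: Flicker1998UnitaryFL, Prop. 11 p. 88] -/
theorem sum_Ico_pow_add_two_mul (hq : 1 < q) (ν : ℕ) {a b : ℕ} (hab : a ≤ b) :
    ∑ m ∈ Ico a b, (q : ℚ) ^ (ν + 2 * m) = (q : ℚ) ^ ν * (((q : ℚ) ^ (2 * b) - (q : ℚ) ^ (2 * a)) / ((q : ℚ) ^ 2 - 1)) := by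
  simp_rw [pow_add]
  rw [← Finset.mul_sum, sum_Ico_pow_mul hq (by norm_num : 0 < 2) hab]

/-! ## §2 The inner sum `S(ν) = Σ_m I(j,m)` of Prop. 10 in closed form -/

/-- **The inner sum of Cor. 9 over Prop. 10's table**: `Σ_{m} I(j,m) = 1 + (1 − q⁻²) Σ_{1 ≤ m ≤ K} q^{4m} + δ(ν = N₊)·(1 + q⁻¹) Σ_{[ν∕2] < m ≤ ν} q^{ν+2m}`,
`K = min([ν∕2], [N₊∕2])`. [cite: Flicker1998UnitaryFL, Prop. 10 p. 85; Prop. 11 p. 88] -/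
theorem innerSumTen_eq (q ν Np : ℕ) :
    innerSumTen q ν Np = 1 + (1 - ((q : ℚ) ^ 2)⁻¹) * ∑ m ∈ Ico 1 (min (ν / 2) (Np / 2) + 1), (q : ℚ) ^ (4 * m) +
      (if ν = Np then (1 + ((q : ℚ))⁻¹) * ∑ m ∈ Ico (ν / 2 + 1) (ν + 1), (q : ℚ) ^ (ν + 2 * m) else 0) := by
  set K := min (ν / 2) (Np / 2) with hK
  have hKν : K + 1 ≤ ν + 1 := by omega
  unfold innerSumTen
  rw [Finset.range_eq_Ico, Finset.sum_eq_sum_Ico_succ_bot (by omega : 0 < ν + 1),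
    ← Finset.sum_Ico_consecutive _ (by omega : 1 ≤ K + 1) hKν]
  have h0 : iTen q ν Np 0 = 1 := by simp [iTen]
  have hmid : ∑ m ∈ Ico 1 (K + 1), iTen q ν Np m = (1 - ((q : ℚ) ^ 2)⁻¹) * ∑ m ∈ Ico 1 (K + 1), (q : ℚ) ^ (4 * m) := by
    rw [Finset.mul_sum]
    refine Finset.sum_congr rfl fun m hm => ?_
    rw [Finset.mem_Ico] at hm
    have h1 : m ≠ 0 := by omega
    have h2 : m ≤ min (ν / 2) (Np / 2) := by omega
    simp only [iTen, if_neg h1, if_pos h2]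
  rw [h0, hmid]
  by_cases hν : ν = Np
  · subst hν
    have hKe : K = ν / 2 := by omega
    have htail : ∑ m ∈ Ico (K + 1) (ν + 1), iTen q ν ν m = (1 + ((q : ℚ))⁻¹) * ∑ m ∈ Ico (ν / 2 + 1) (ν + 1), (q : ℚ) ^ (ν + 2 * m) := by
      rw [hKe, Finset.mul_sum]
      refine Finset.sum_congr rfl fun m hm => ?_
      rw [Finset.mem_Ico] at hm
      have h1 : m ≠ 0 := by omega
      have h2 : ¬ m ≤ min (ν / 2) (ν / 2) := by omega
      have h3 : ν < 2 * m ∧ m ≤ ν := ⟨by omega, by omega⟩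
      simp only [iTen, if_neg h1, if_neg h2, true_and, if_pos h3]
    rw [htail, if_pos rfl]
    ring
  · have htail : ∑ m ∈ Ico (K + 1) (ν + 1), iTen q ν Np m = 0 := by
      refine Finset.sum_eq_zero fun m hm => ?_
      rw [Finset.mem_Ico] at hm
      have h1 : m ≠ 0 := by omega
      have h2 : ¬ m ≤ min (ν / 2) (Np / 2) := by omega
      have h3 : ¬ (ν = Np ∧ ν < 2 * m ∧ m ≤ ν) := fun h => hν h.1
      simp only [iTen, if_neg h1, if_neg h2, if_neg h3]
    rw [htail, if_neg hν]
    ring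

/-- The inner sum in CLOSED FORM (geometric series summed). [cite: Flicker1998UnitaryFL, Prop. 11 p. 88] -/
theorem innerSumTen_eq_closed (hq : 1 < q) (ν Np : ℕ) :
    innerSumTen q ν Np = 1 + (1 - ((q : ℚ) ^ 2)⁻¹) * (((q : ℚ) ^ (4 * (min (ν / 2) (Np / 2) + 1)) - (q : ℚ) ^ 4) / ((q : ℚ) ^ 4 - 1)) +
      (if ν = Np then (1 + ((q : ℚ))⁻¹) * ((q : ℚ) ^ ν * (((q : ℚ) ^ (2 * (ν + 1)) - (q : ℚ) ^ (2 * (ν / 2 + 1))) / ((q : ℚ) ^ 2 - 1))) else 0) := by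
  rw [innerSumTen_eq, sum_Ico_one_pow_four hq, sum_Ico_pow_add_two_mul hq ν (by omega : ν / 2 + 1 ≤ ν + 1)]

/-! ## §3 The recurrence of Cor. 9's double sum -/

/-- `w(1) = (1 + q⁻¹) q`. [cite: Flicker1998UnitaryFL, Cor. 9 p. 85] -/
theorem corNineWeight_one (q : ℕ) : corNineWeight q 1 = (1 + ((q : ℚ))⁻¹) * (q : ℚ) := by
  simp [corNineWeight]

/-- `w(j + 2) = q² w(j)` for `j ≥ 1`. [cite: Flicker1998UnitaryFL, Cor. 9 p. 85] -/
theorem corNineWeight_add_two {j : ℕ} (hj : j ≠ 0) : corNineWeight q (j + 2) = (q : ℚ) ^ 2 * corNineWeight q j := by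
  simp only [corNineWeight, if_neg hj, if_neg (Nat.succ_ne_zero (j + 1)), pow_add]
  ring

/-- **THE RECURRENCE** `Φ(N+2) = q² Φ(N) + w(1) S(N+1)` of Cor. 9's double sum (re-indexed by `ν = N − j`: the new top term `ν = N+1`, `j = 1`; every other `j` grows by `2`).
[cite: Flicker1998UnitaryFL, Cor. 9 p. 85] -/
theorem sumThetaOne_add_two (q N Np : ℕ) :
    sumThetaOne q (N + 2) Np = (q : ℚ) ^ 2 * sumThetaOne q N Np + corNineWeight q 1 * innerSumTen q (N + 1) Np := by
  unfold sumThetaOne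
  rw [Finset.sum_range_succ, Finset.sum_range_succ, Finset.mul_sum]
  have hN1 : N + 2 - (N + 1) = 1 := by omega
  have hN0 : ¬ (N + 2 - N) % 2 = 1 := by omega
  rw [hN1, if_pos (by norm_num : 1 % 2 = 1), if_neg hN0, add_zero]
  congr 1
  refine Finset.sum_congr rfl fun ν hν => ?_
  rw [Finset.mem_range] at hν
  have hpar : (N + 2 - ν) % 2 = (N - ν) % 2 := by omega
  have hsub : N + 2 - ν = (N - ν) + 2 := by omega
  have hne : N - ν ≠ 0 := by omega
  rw [hpar, hsub, corNineWeight_add_two hne]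
  split_ifs <;> ring

/-- `Φ(0) = 0`. [cite: Flicker1998UnitaryFL, Cor. 9 p. 85] -/
theorem sumThetaOne_zero (q Np : ℕ) : sumThetaOne q 0 Np = 0 := by
  simp [sumThetaOne]

/-- `Φ(1) = w(1)·S(0) = q + 1`. [cite: Flicker1998UnitaryFL, Cor. 9 p. 85] -/
theorem sumThetaOne_one (hq : 1 < q) (Np : ℕ) : sumThetaOne q 1 Np = (q : ℚ) + 1 := by
  have hq0 : (q : ℚ) ≠ 0 := by exact_mod_cast (by omega : q ≠ 0)
  have hS : innerSumTen q 0 Np = 1 := by simp [innerSumTen, iTen]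
  simp only [sumThetaOne, Finset.sum_range_one, Nat.sub_zero, Nat.one_mod, if_true, hS, corNineWeight_one, mul_one]
  rw [add_mul, one_mul, inv_mul_cancel₀ hq0]

/-! ## §4 The printed closed form satisfies the same recurrence -/

/-- `phiOne q N₊ 0 = 0`. [cite: Flicker1998UnitaryFL, Prop. 11 p. 87] -/
theorem phiOne_zero (q Np : ℕ) : phiOne q Np 0 = 0 := by
  simp [phiOne]

/-- `phiOne q N₊ 1 = q + 1` (both printed branches). [cite: Flicker1998UnitaryFL, Prop. 11 p. 87] -/
theorem phiOne_one (hq : 1 < q) (Np : ℕ) : phiOne q Np 1 = (q : ℚ) + 1 := by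
  have h1 := cast_sub_one_ne_zero hq
  have h4 := cast_pow_four_sub_one_ne_zero hq
  by_cases hNp : 1 ≤ Np
  · simp only [phiOne, if_pos hNp, show 4 * ((1 + 1) / 2) = 4 from rfl]
    exact div_mul_cancel₀ _ h4
  · have hNp0 : Np = 0 := by omega
    subst hNp0
    simp only [phiOne, show ¬ (1 : ℕ) ≤ 0 from by omega, if_false, Nat.zero_div, mul_zero, add_zero, Nat.sub_self,
      Nat.zero_mod, if_true, pow_one]
    field_simp
    ring

/-- **The printed closed form obeys the recurrence**: `φ₁(N₊, N+2) = q² φ₁(N₊, N) + w(1) S(N+1)` for all `N`, `N₊` — Flicker's pp. 88–89 in four position cases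
(`N+2 ≤ N₊`, `N+1 = N₊`, `N = N₊`, `N₊ < N`) times the parities. [cite: Flicker1998UnitaryFL, Prop. 11 pp. 87–89] -/
theorem phiOne_add_two (hq : 1 < q) (N Np : ℕ) :
    phiOne q Np (N + 2) = (q : ℚ) ^ 2 * phiOne q Np N + corNineWeight q 1 * innerSumTen q (N + 1) Np := by
  have h1 := cast_sub_one_ne_zero hq
  have h2 := cast_pow_sub_one_ne_zero hq (by norm_num : 0 < 2)
  have h4 := cast_pow_four_sub_one_ne_zero hq
  have hq0 : (q : ℚ) ≠ 0 := by exact_mod_cast (by omega : q ≠ 0)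
  rw [innerSumTen_eq_closed hq, corNineWeight_one]
  rcases lt_trichotomy (N + 1) Np with hlt | heq | hgt
  · -- N + 2 ≤ Np
    have hmin : min ((N + 1) / 2) (Np / 2) = (N + 1) / 2 := min_eq_left (by omega)
    simp only [phiOne, if_pos (show N + 2 ≤ Np by omega), if_pos (show N ≤ Np by omega), if_neg (show N + 1 ≠ Np by omega), hmin, add_zero]
    obtain ⟨a, rfl | rfl⟩ := Nat.even_or_odd' N
    · rw [show (2 * a + 2 + 1) / 2 = a + 1 by omega, show (2 * a + 1) / 2 = a by omega]
      field_simp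
      ring
    · rw [show (2 * a + 1 + 2 + 1) / 2 = a + 2 by omega, show (2 * a + 1 + 1) / 2 = a + 1 by omega]
      field_simp
      ring
  · -- N + 1 = Np
    subst heq
    have hmin : min ((N + 1) / 2) ((N + 1) / 2) = (N + 1) / 2 := min_self _
    simp only [phiOne, if_neg (show ¬ N + 2 ≤ N + 1 by omega), if_pos (show N ≤ N + 1 by omega), if_true, hmin,
      show N + 2 - 1 - (N + 1) = 0 by omega, Nat.zero_mod]
    obtain ⟨a, rfl | rfl⟩ := Nat.even_or_odd' N
    · rw [show (2 * a + 1) / 2 = a by omega, show 2 * a + 2 + (2 * a + 1) = 4 * a + 3 by omega,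
        show (-(q : ℚ)) ^ (4 * a + 3) = -(q : ℚ) ^ (4 * a + 3) from Odd.neg_pow ⟨2 * a + 1, by ring⟩ _]
      field_simp
      ring
    · rw [show (2 * a + 1 + 1) / 2 = a + 1 by omega, show 2 * a + 1 + 2 + (2 * a + 1 + 1) = 4 * a + 5 by omega,
        show (-(q : ℚ)) ^ (4 * a + 5) = -(q : ℚ) ^ (4 * a + 5) from Odd.neg_pow ⟨2 * a + 2, by ring⟩ _]
      field_simp
      ring
  · rcases (show Np = N ∨ Np < N by omega) with heq | hlt
    · -- N = Np
      subst heq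
      simp only [phiOne, if_neg (show ¬ Np + 2 ≤ Np by omega), if_pos le_rfl, if_neg (show Np + 1 ≠ Np by omega), add_zero,
        show Np + 2 - 1 - Np = 1 by omega, Nat.one_mod]
      obtain ⟨a, rfl | rfl⟩ := Nat.even_or_odd' Np
      · rw [show min ((2 * a + 1) / 2) (2 * a / 2) = a by omega, show (2 * a + 1) / 2 = a by omega, show 2 * a / 2 = a by omega,
          show 2 * a + 2 + 2 * a = 4 * a + 2 by omega, show (-(q : ℚ)) ^ (4 * a + 2) = (q : ℚ) ^ (4 * a + 2) from Even.neg_pow ⟨2 * a + 1, by ring⟩ _]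
        norm_num
        field_simp
        ring
      · rw [show min ((2 * a + 1 + 1) / 2) ((2 * a + 1) / 2) = a by omega, show (2 * a + 1 + 1) / 2 = a + 1 by omega, show (2 * a + 1) / 2 = a by omega,
          show 2 * a + 1 + 2 + (2 * a + 1) = 4 * a + 4 by omega, show (-(q : ℚ)) ^ (4 * a + 4) = (q : ℚ) ^ (4 * a + 4) from Even.neg_pow ⟨2 * a + 2, by ring⟩ _]
        norm_num
        field_simp
        ring
    · -- Np < N
      have hmin : min ((N + 1) / 2) (Np / 2) = Np / 2 := min_eq_right (by omega)
      simp only [phiOne, if_neg (show ¬ N + 2 ≤ Np by omega), if_neg (show ¬ N ≤ Np by omega), if_neg (show N + 1 ≠ Np by omega), hmin, add_zero,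
        show (N + 2 - 1 - Np) % 2 = (N - 1 - Np) % 2 by omega]
      obtain ⟨d, hd | hd⟩ := Nat.even_or_odd' (N - Np)
      · -- N - Np even
        have hpar : ¬ (N - 1 - Np) % 2 = 0 := by omega
        rw [if_neg hpar, if_neg hpar]
        obtain ⟨b, rfl | rfl⟩ := Nat.even_or_odd' Np
        · have hN : N = 2 * b + 2 * d := by omega
          subst hN
          rw [show 2 * b / 2 = b by omega, show 2 * b + 2 * d + 2 + 2 * b = 4 * b + 2 * d + 2 by omega, show 2 * b + 2 * d + 2 * b = 4 * b + 2 * d by omega,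
            show (-(q : ℚ)) ^ (4 * b + 2 * d + 2) = (q : ℚ) ^ (4 * b + 2 * d + 2) from Even.neg_pow ⟨2 * b + d + 1, by ring⟩ _,
            show (-(q : ℚ)) ^ (4 * b + 2 * d) = (q : ℚ) ^ (4 * b + 2 * d) from Even.neg_pow ⟨2 * b + d, by ring⟩ _]
          field_simp
          ring
        · have hN : N = 2 * b + 1 + 2 * d := by omega
          subst hN
          rw [show (2 * b + 1) / 2 = b by omega, show 2 * b + 1 + 2 * d + 2 + (2 * b + 1) = 4 * b + 2 * d + 4 by omega,
            show 2 * b + 1 + 2 * d + (2 * b + 1) = 4 * b + 2 * d + 2 by omega,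
            show (-(q : ℚ)) ^ (4 * b + 2 * d + 4) = (q : ℚ) ^ (4 * b + 2 * d + 4) from Even.neg_pow ⟨2 * b + d + 2, by ring⟩ _,
            show (-(q : ℚ)) ^ (4 * b + 2 * d + 2) = (q : ℚ) ^ (4 * b + 2 * d + 2) from Even.neg_pow ⟨2 * b + d + 1, by ring⟩ _]
          field_simp
          ring
      · -- N - Np odd
        have hpar : (N - 1 - Np) % 2 = 0 := by omega
        rw [if_pos hpar, if_pos hpar]
        obtain ⟨b, rfl | rfl⟩ := Nat.even_or_odd' Np
        · have hN : N = 2 * b + 2 * d + 1 := by omega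
          subst hN
          rw [show 2 * b / 2 = b by omega, show 2 * b + 2 * d + 1 + 2 + 2 * b = 4 * b + 2 * d + 3 by omega, show 2 * b + 2 * d + 1 + 2 * b = 4 * b + 2 * d + 1 by omega,
            show (-(q : ℚ)) ^ (4 * b + 2 * d + 3) = -(q : ℚ) ^ (4 * b + 2 * d + 3) from Odd.neg_pow ⟨2 * b + d + 1, by ring⟩ _,
            show (-(q : ℚ)) ^ (4 * b + 2 * d + 1) = -(q : ℚ) ^ (4 * b + 2 * d + 1) from Odd.neg_pow ⟨2 * b + d, by ring⟩ _]
          field_simp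
          ring
        · have hN : N = 2 * b + 1 + 2 * d + 1 := by omega
          subst hN
          rw [show (2 * b + 1) / 2 = b by omega, show 2 * b + 1 + 2 * d + 1 + 2 + (2 * b + 1) = 4 * b + 2 * d + 5 by omega,
            show 2 * b + 1 + 2 * d + 1 + (2 * b + 1) = 4 * b + 2 * d + 3 by omega,
            show (-(q : ℚ)) ^ (4 * b + 2 * d + 5) = -(q : ℚ) ^ (4 * b + 2 * d + 5) from Odd.neg_pow ⟨2 * b + d + 2, by ring⟩ _,
            show (-(q : ℚ)) ^ (4 * b + 2 * d + 3) = -(q : ℚ) ^ (4 * b + 2 * d + 3) from Odd.neg_pow ⟨2 * b + d + 1, by ring⟩ _]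
          field_simp
          ring

/-! ## §5 Prop. 11 from Prop. 10 -/

/-- **«Cor. 9 + Prop. 10 ⇒ Prop. 11»**: Cor. 9's double sum over Prop. 10's printed table equals the printed closed form of Prop. 11, for EVERY `q > 1`, `N`, `N₊`:
`Σ_{j odd ≤ N} [R_E^× : R_E(j)^×] Σ_m I(j,m) = φ₁(N₊, N)`. [cite: Flicker1998UnitaryFL, Prop. 11 pp. 87–89; Cor. 9 p. 85; Prop. 10 p. 85] -/
theorem sumThetaOne_eq_phiOne (hq : 1 < q) (N Np : ℕ) : sumThetaOne q N Np = phiOne q Np N := by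
  induction N using Nat.twoStepInduction with
  | zero => rw [sumThetaOne_zero, phiOne_zero]
  | one => rw [sumThetaOne_one hq, phiOne_one hq]
  | more N ih0 ih1 => rw [sumThetaOne_add_two, phiOne_add_two hq, ih0]

end Literature.NumberTheory.Rogawski1990.Flicker1998
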